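import Summits.ABC.ABC.Theses.TwistAmplification
import Literature.NumberTheory.DiophantineGeometry.AbcShapeReductionCount
import Literature.NumberTheory.DiophantineGeometry.AbcExceptionalSetBoundsMainProofs

/-!
# `TwistAmplification.MazurKaneLaw` (stmt-ABC-2757), line `peyre-level-torsor-v22`:
# stub `SliceClassBoundHigh`

The PER-CLASS exponent bookkeeping of the line on the radical slices `s ∈ [5/3, 2)`, from the
RESTRICTED lever (the shape-level bound assumed only on the high-slice data). In the tree's shape
language (`AbcShapes`: `n = c₁ ∏ᵢ xᵢ^{i+1}`, coordinate `0` linear, `1` square, `≥ 2` level; a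
class of abc triples at dyadic scale `C₀` has data `(C₀; c₁, c₂, c₃; X, Y, Z)` subject to
`AbcShapes.Admissible`), write `P = ∏ᵢ XᵢYᵢZᵢ`, `P₀ = X₀Y₀Z₀`, `P₁ = X₁Y₁Z₁`,
`Q = ∏_{i ≥ 2} XᵢYᵢZᵢ`, `V = c₃ · shapeVal Z`, `Λ = 2C₀`, `M = numShapes ε ≥ 6`.

**Statement.** Assume the restricted shape-level bound: for `5/3 ≤ s < 2`, `0 < ε ≤ 1/4`,
`0 < η ≤ 1/12` there is `K` with `shapeCount ≤ K · V^ε · (Q + P / V)` on all data admissible for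
`(s + ε, ε)` satisfying the slice lower bound `C₀^{s-η} ≤ Λ^{3ε/2} 8^M P`. Then for the same
ranges of `s, ε, η` there is `K' ≥ 0` such that on the same data
`shapeCount ≤ K' · C₀^{s - 1 + 5ε + η}`.

**Proof** (pure real inequalities). (i) `V ≤ Λ` gives `V^ε ≤ 2^ε C₀^ε`. (ii) Main term:
`C₀ ≤ V₂ · V` (`V₂ = shapeVal (2, …, 2)`) and `P ≤ Λ^{s+4ε}` give `P/V ≤ 2^{s+4ε} V₂ · C₀^{s+4ε-1}`.
(iii) Level term: the structure inequality `P³ ≤ Λ³ P₀² P₁` (every exponent `i + 1` with `i ≥ 2`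
is `≥ 3`; adapted from `Lines/critical-kloosterman-powerful-moduli.lean`) and `P = P₀P₁Q`,
`P₁ ≥ 1` give `Q² P ≤ Λ³`; with the slice lower bound, `Q² C₀^{s-η} ≤ Λ^{3+3ε/2} 8^M`, so
`Q ≤ (2^{3+3ε/2} 8^M)^{1/2} · C₀^{(3-s)/2 + 3ε/4 + η/2}`. (iv) Since `s ≥ 5/3` one has
`(3-s)/2 ≤ s-1`, so both exponents plus the `ε` of (i) are `≤ s - 1 + 5ε + η`, and `C₀ ≥ 1`.
-/

namespace Summit.ABC.ABC.Theorems

open Finset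
open Literature.NumberTheory.DiophantineGeometry
open Literature.NumberTheory.DiophantineGeometry.AbcShapes

/-! ## The structure inequality (adapted from `Lines/critical-kloosterman-powerful-moduli.lean`) -/

-- adapted from Lines/critical-kloosterman-powerful-moduli.lean (`prod_pow_three_le`)
/-- One shape tuple: `(∏ᵢ xᵢ)³ ≤ (∏ᵢ xᵢ^{i+1}) · x₀² · x₁`, because every exponent `i + 1` with
`i ≥ 2` is `≥ 3`. [folklore] -/
private theorem sliceClassBoundHigh_prod_pow_three_le {M : ℕ} (X : Fin M → ℕ) (hX : ∀ i, 0 < X i)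
    (i₀ i₁ : Fin M) (h0 : (i₀ : ℕ) = 0) (h1 : (i₁ : ℕ) = 1) :
    (∏ i, X i) ^ 3 ≤ shapeVal X * (X i₀ ^ 2 * X i₁) := by
  obtain ⟨m, rfl⟩ : ∃ m, M = m + 2 := ⟨M - 2, by have := i₁.isLt; omega⟩
  have hi0 : i₀ = 0 := Fin.ext h0
  have hi1 : i₁ = 1 := Fin.ext (by simp [h1])
  rw [hi0, hi1, shapeVal, Fin.prod_univ_succ, Fin.prod_univ_succ (n := m),
    Fin.prod_univ_succ (f := fun i : Fin (m + 2) => X i ^ ((i : ℕ) + 1)),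
    Fin.prod_univ_succ (f := fun i : Fin (m + 1) => X i.succ ^ ((i.succ : ℕ) + 1))]
  simp only [Fin.val_zero, Fin.val_succ, zero_add, pow_one, Fin.succ_zero_eq_one]
  set T : ℕ := ∏ i : Fin m, X i.succ.succ with hTdef
  set T' : ℕ := ∏ i : Fin m, X i.succ.succ ^ ((i : ℕ) + 1 + 1 + 1) with hT'def
  have hT : T ^ 3 ≤ T' := by
    rw [hTdef, hT'def, ← prod_pow]
    refine prod_le_prod (fun i _ => Nat.zero_le _) fun i _ => ?_
    exact Nat.pow_le_pow_right (hX _) (by omega)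
  calc (X 0 * (X 1 * T)) ^ 3 = X 0 * X 1 ^ (1 + 1) * (X 0 ^ 2 * X 1) * T ^ 3 := by ring
    _ ≤ X 0 * X 1 ^ (1 + 1) * (X 0 ^ 2 * X 1) * T' := Nat.mul_le_mul_left _ hT
    _ = X 0 * (X 1 ^ (1 + 1) * T') * (X 0 ^ 2 * X 1) := by ring

-- adapted from Lines/critical-kloosterman-powerful-moduli.lean (`prod_cube_le`)
/-- The structure inequality
`(∏ XᵢYᵢZᵢ)³ ≤ (c₁·shapeVal X)(c₂·shapeVal Y)(c₃·shapeVal Z) · (X₀Y₀Z₀)² (X₁Y₁Z₁)`. [folklore] -/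
private theorem sliceClassBoundHigh_prod_cube_le {M : ℕ} {c₁ c₂ c₃ : ℕ} (hc₁ : 0 < c₁)
    (hc₂ : 0 < c₂) (hc₃ : 0 < c₃) (X Y Z : Fin M → ℕ) (hX : ∀ i, 0 < X i) (hY : ∀ i, 0 < Y i)
    (hZ : ∀ i, 0 < Z i) (i₀ i₁ : Fin M) (h0 : (i₀ : ℕ) = 0) (h1 : (i₁ : ℕ) = 1) :
    (∏ i, ((X i : ℝ) * Y i * Z i)) ^ 3 ≤
      ((c₁ * shapeVal X : ℕ) : ℝ) * ((c₂ * shapeVal Y : ℕ) : ℝ) * ((c₃ * shapeVal Z : ℕ) : ℝ) *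
        (((X i₀ : ℝ) * Y i₀ * Z i₀) ^ 2 * ((X i₁ : ℝ) * Y i₁ * Z i₁)) := by
  have hx := sliceClassBoundHigh_prod_pow_three_le X hX i₀ i₁ h0 h1
  have hy := sliceClassBoundHigh_prod_pow_three_le Y hY i₀ i₁ h0 h1
  have hz := sliceClassBoundHigh_prod_pow_three_le Z hZ i₀ i₁ h0 h1
  have hx' : (∏ i, X i) ^ 3 ≤ c₁ * shapeVal X * (X i₀ ^ 2 * X i₁) :=
    hx.trans (Nat.mul_le_mul_right _ (Nat.le_mul_of_pos_left _ hc₁))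
  have hy' : (∏ i, Y i) ^ 3 ≤ c₂ * shapeVal Y * (Y i₀ ^ 2 * Y i₁) :=
    hy.trans (Nat.mul_le_mul_right _ (Nat.le_mul_of_pos_left _ hc₂))
  have hz' : (∏ i, Z i) ^ 3 ≤ c₃ * shapeVal Z * (Z i₀ ^ 2 * Z i₁) :=
    hz.trans (Nat.mul_le_mul_right _ (Nat.le_mul_of_pos_left _ hc₃))
  have hnat : ((∏ i, X i) * (∏ i, Y i) * (∏ i, Z i)) ^ 3 ≤
      (c₁ * shapeVal X) * (c₂ * shapeVal Y) * (c₃ * shapeVal Z) *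
        ((X i₀ * Y i₀ * Z i₀) ^ 2 * (X i₁ * Y i₁ * Z i₁)) := by
    calc ((∏ i, X i) * (∏ i, Y i) * (∏ i, Z i)) ^ 3
        = (∏ i, X i) ^ 3 * (∏ i, Y i) ^ 3 * (∏ i, Z i) ^ 3 := by ring
      _ ≤ (c₁ * shapeVal X * (X i₀ ^ 2 * X i₁)) * (c₂ * shapeVal Y * (Y i₀ ^ 2 * Y i₁)) *
            (c₃ * shapeVal Z * (Z i₀ ^ 2 * Z i₁)) :=
          Nat.mul_le_mul (Nat.mul_le_mul hx' hy') hz'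
      _ = (c₁ * shapeVal X) * (c₂ * shapeVal Y) * (c₃ * shapeVal Z) *
            ((X i₀ * Y i₀ * Z i₀) ^ 2 * (X i₁ * Y i₁ * Z i₁)) := by ring
  have hR : (∏ i, ((X i : ℝ) * Y i * Z i)) =
      (((∏ i, X i) * (∏ i, Y i) * (∏ i, Z i) : ℕ) : ℝ) := by
    push_cast
    simp only [prod_mul_distrib]
  rw [hR]
  exact_mod_cast hnat

/-- The structure inequality on admissible data: with `cⱼ · shapeVal ≤ 2C₀`,
`(∏ XᵢYᵢZᵢ)³ ≤ (2C₀)³ · (X₀Y₀Z₀)² (X₁Y₁Z₁)`. [folklore] -/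
private theorem sliceClassBoundHigh_prod_cube_le_admissible {l ε : ℝ} {M : ℕ} {C₀ c₁ c₂ c₃ : ℕ}
    {X Y Z : Fin M → ℕ} (hA : Admissible l ε C₀ c₁ c₂ c₃ X Y Z) (i₀ i₁ : Fin M)
    (h0 : (i₀ : ℕ) = 0) (h1 : (i₁ : ℕ) = 1) :
    (∏ i, ((X i : ℝ) * Y i * Z i)) ^ 3 ≤
      (2 * (C₀ : ℝ)) ^ 3 * (((X i₀ : ℝ) * Y i₀ * Z i₀) ^ 2 * ((X i₁ : ℝ) * Y i₁ * Z i₁)) := by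
  have h := sliceClassBoundHigh_prod_cube_le hA.pos₁ hA.pos₂ hA.pos₃ X Y Z hA.X_pos hA.Y_pos
    hA.Z_pos i₀ i₁ h0 h1
  have hX' : ((c₁ * shapeVal X : ℕ) : ℝ) ≤ 2 * (C₀ : ℝ) := by exact_mod_cast hA.valX_le
  have hY' : ((c₂ * shapeVal Y : ℕ) : ℝ) ≤ 2 * (C₀ : ℝ) := by exact_mod_cast hA.valY_le
  have hZ' : ((c₃ * shapeVal Z : ℕ) : ℝ) ≤ 2 * (C₀ : ℝ) := by exact_mod_cast hA.valZ_le
  refine h.trans ?_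
  calc _ ≤ (2 * (C₀ : ℝ)) * (2 * (C₀ : ℝ)) * (2 * (C₀ : ℝ)) *
        (((X i₀ : ℝ) * Y i₀ * Z i₀) ^ 2 * ((X i₁ : ℝ) * Y i₁ * Z i₁)) := by gcongr
    _ = _ := by ring

/-! ## Splitting the product and the real-inequality bookkeeping -/

/-- Splitting a product over `Fin M` into the coordinates `0`, `1` and the levels `i ≥ 2`:
`∏ᵢ fᵢ = f₀ · f₁ · ∏_{i ≥ 2} fᵢ`. [folklore] -/
private theorem sliceClassBoundHigh_prod_split {M : ℕ} (f : Fin M → ℝ) (i₀ i₁ : Fin M)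
    (h0 : (i₀ : ℕ) = 0) (h1 : (i₁ : ℕ) = 1) :
    ∏ i, f i = f i₀ * f i₁ * ∏ i ∈ Finset.univ.filter (fun i : Fin M => 2 ≤ (i : ℕ)), f i := by
  have hc : Finset.univ.filter (fun i : Fin M => ¬ 2 ≤ (i : ℕ)) = {i₀, i₁} := by
    ext i
    simp only [Finset.mem_filter, Finset.mem_univ, true_and, Finset.mem_insert,
      Finset.mem_singleton, Fin.ext_iff]
    omega
  have hne : i₀ ≠ i₁ := by
    intro h
    rw [Fin.ext_iff] at h
    omega
  have h := Finset.prod_filter_mul_prod_filter_not Finset.univ (fun i : Fin M => 2 ≤ (i : ℕ)) f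
  rw [← h, hc, Finset.prod_pair hne]
  ring

/-- `V ≤ 2c` gives `V^ε ≤ 2^ε · c^ε`. [folklore] -/
private theorem sliceClassBoundHigh_rpow_le {V c ε : ℝ} (hV : 0 ≤ V) (hc : 0 ≤ c) (hε : 0 ≤ ε)
    (hVc : V ≤ 2 * c) : V ^ ε ≤ (2 : ℝ) ^ ε * c ^ ε := by
  rw [← Real.mul_rpow (by norm_num) hc]
  exact Real.rpow_le_rpow hV hVc hε

/-- The main term: `P / V ≤ 2^l V₂ · c^{l-1}` from `P ≤ (2c)^l` and `c ≤ V₂ · V`. [folklore] -/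
private theorem sliceClassBoundHigh_main_term {P V V₂ c l : ℝ} (hP0 : 0 ≤ P) (hV : 0 < V)
    (hc : 0 < c) (hV₂ : 0 ≤ V₂) (hcV : c ≤ V₂ * V) (hP : P ≤ (2 * c) ^ l) :
    P / V ≤ (2 : ℝ) ^ l * V₂ * c ^ (l - 1) := by
  have h1 : P / V ≤ P * V₂ / c := by
    rw [div_le_div_iff₀ hV hc]
    calc P * c ≤ P * (V₂ * V) := mul_le_mul_of_nonneg_left hcV hP0
      _ = P * V₂ * V := by ring
  calc P / V ≤ P * V₂ / c := h1
    _ ≤ (2 * c) ^ l * V₂ / c :=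
        div_le_div_of_nonneg_right (mul_le_mul_of_nonneg_right hP hV₂) hc.le
    _ = (2 : ℝ) ^ l * V₂ * c ^ (l - 1) := by
        rw [Real.mul_rpow (by norm_num) hc.le, Real.rpow_sub_one hc.ne']
        ring

/-- The level term, squared: from the structure inequality `P³ ≤ (2c)³ P₀² P₁`, the splitting
`P = P₀ P₁ Q` with `P₁ ≥ 1`, and the slice lower bound `c^{s-η} ≤ (2c)^{3ε/2} 8^M P`:
`Q² ≤ 2^{3+3ε/2} 8^M · c^{2((3-s)/2 + 3ε/4 + η/2)}`. [folklore] -/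
private theorem sliceClassBoundHigh_level_sq {P P₀ P₁ Q c s ε η : ℝ} {M : ℕ} (hc : 0 < c)
    (hQ0 : 0 ≤ Q) (hP₀ : 0 < P₀) (hP₁ : 1 ≤ P₁) (hsplit : P = P₀ * P₁ * Q)
    (hcube : P ^ 3 ≤ (2 * c) ^ 3 * (P₀ ^ 2 * P₁))
    (hSL : c ^ (s - η) ≤ (2 * c) ^ (3 * ε / 2) * 8 ^ M * P) :
    Q ^ 2 ≤ ((2 : ℝ) ^ (3 + 3 * ε / 2) * 8 ^ M) * c ^ (2 * ((3 - s) / 2 + 3 * ε / 4 + η / 2)) := by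
  have hP₁0 : 0 < P₁ := by linarith
  -- (a) `Q² P ≤ (2c)³`
  have hQP : Q ^ 2 * P ≤ (2 * c) ^ 3 := by
    have hpos : 0 < P₀ ^ 2 * P₁ := by positivity
    refine le_of_mul_le_mul_right ?_ hpos
    calc Q ^ 2 * P * (P₀ ^ 2 * P₁) = (P₀ ^ 3 * P₁ ^ 2) * Q ^ 3 := by rw [hsplit]; ring
      _ ≤ (P₀ ^ 3 * P₁ ^ 3) * Q ^ 3 :=
          mul_le_mul_of_nonneg_right
            (mul_le_mul_of_nonneg_left (pow_le_pow_right₀ hP₁ (by norm_num)) (by positivity))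
            (pow_nonneg hQ0 3)
      _ = P ^ 3 := by rw [hsplit]; ring
      _ ≤ (2 * c) ^ 3 * (P₀ ^ 2 * P₁) := hcube
  -- (b) `Q² c^{s-η} ≤ (2c)^{3ε/2} 8^M (2c)³ = 2^{3+3ε/2} 8^M c^{3+3ε/2}`
  have h2c : (0 : ℝ) < 2 * c := by positivity
  have hQc : Q ^ 2 * c ^ (s - η) ≤ ((2 : ℝ) ^ (3 + 3 * ε / 2) * 8 ^ M) * c ^ (3 + 3 * ε / 2) := by
    calc Q ^ 2 * c ^ (s - η) ≤ Q ^ 2 * ((2 * c) ^ (3 * ε / 2) * 8 ^ M * P) :=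
          mul_le_mul_of_nonneg_left hSL (sq_nonneg _)
      _ = (2 * c) ^ (3 * ε / 2) * 8 ^ M * (Q ^ 2 * P) := by ring
      _ ≤ (2 * c) ^ (3 * ε / 2) * 8 ^ M * (2 * c) ^ 3 :=
          mul_le_mul_of_nonneg_left hQP (by positivity)
      _ = 8 ^ M * ((2 * c) ^ (3 : ℝ) * (2 * c) ^ (3 * ε / 2)) := by
          rw [Real.rpow_ofNat]
          ring
      _ = ((2 : ℝ) ^ (3 + 3 * ε / 2) * 8 ^ M) * c ^ (3 + 3 * ε / 2) := by
          rw [← Real.rpow_add h2c, Real.mul_rpow (by norm_num) hc.le]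
          ring
  -- (c) divide by `c^{s-η}`
  have hce : 0 < c ^ (s - η) := Real.rpow_pos_of_pos hc _
  refine le_of_mul_le_mul_right (hQc.trans_eq ?_) hce
  rw [mul_assoc ((2 : ℝ) ^ (3 + 3 * ε / 2) * 8 ^ M), ← Real.rpow_add hc,
    show 2 * ((3 - s) / 2 + 3 * ε / 4 + η / 2) + (s - η) = 3 + 3 * ε / 2 by ring]

/-- From `Q² ≤ A · c^{2e}` to `Q ≤ √A · c^e`. [folklore] -/
private theorem sliceClassBoundHigh_le_sqrt_mul_rpow {Q A c e : ℝ} (hQ : 0 ≤ Q) (hA : 0 ≤ A)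
    (hc : 0 < c) (h : Q ^ 2 ≤ A * c ^ (2 * e)) : Q ≤ Real.sqrt A * c ^ e := by
  have hB : 0 ≤ Real.sqrt A * c ^ e := by positivity
  rw [← pow_le_pow_iff_left₀ hQ hB two_ne_zero, mul_pow, Real.sq_sqrt hA,
    ← Real.rpow_mul_natCast hc.le e 2, Nat.cast_ofNat, mul_comm e 2]
  exact h

/-- Assembly of the three bounds: if `B ≤ K · W · (Q + R)` with `W ≤ 2^ε c^ε`, `Q ≤ A_Q c^{e_Q}`,
`R ≤ A_P c^{e_P}`, `ε + e_Q ≤ E`, `ε + e_P ≤ E` and `c ≥ 1`, then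
`B ≤ K · 2^ε · (A_Q + A_P) · c^E`. [folklore] -/
private theorem sliceClassBoundHigh_assemble {B K W Q R c ε AQ AP eQ eP E : ℝ} (hK : 0 ≤ K)
    (hc : 1 ≤ c) (hW : W ≤ (2 : ℝ) ^ ε * c ^ ε) (hQ0 : 0 ≤ Q) (hQ : Q ≤ AQ * c ^ eQ)
    (hR0 : 0 ≤ R) (hR : R ≤ AP * c ^ eP) (hAQ : 0 ≤ AQ) (hAP : 0 ≤ AP) (heQ : ε + eQ ≤ E)
    (heP : ε + eP ≤ E) (hB : B ≤ K * W * (Q + R)) :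
    B ≤ K * (2 : ℝ) ^ ε * (AQ + AP) * c ^ E := by
  have hc0 : 0 < c := by linarith
  have hW' : 0 ≤ (2 : ℝ) ^ ε * c ^ ε := by positivity
  have h1 : K * W * (Q + R) ≤ K * ((2 : ℝ) ^ ε * c ^ ε) * (AQ * c ^ eQ + AP * c ^ eP) :=
    mul_le_mul (mul_le_mul_of_nonneg_left hW hK) (add_le_add hQ hR) (add_nonneg hQ0 hR0)
      (mul_nonneg hK hW')
  have h2 : c ^ ε * c ^ eQ ≤ c ^ E := by
    rw [← Real.rpow_add hc0]
    exact Real.rpow_le_rpow_of_exponent_le hc heQ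
  have h3 : c ^ ε * c ^ eP ≤ c ^ E := by
    rw [← Real.rpow_add hc0]
    exact Real.rpow_le_rpow_of_exponent_le hc heP
  have h4 : 0 ≤ K * (2 : ℝ) ^ ε := by positivity
  calc B ≤ K * W * (Q + R) := hB
    _ ≤ K * ((2 : ℝ) ^ ε * c ^ ε) * (AQ * c ^ eQ + AP * c ^ eP) := h1
    _ = K * (2 : ℝ) ^ ε * (AQ * (c ^ ε * c ^ eQ) + AP * (c ^ ε * c ^ eP)) := by ring
    _ ≤ K * (2 : ℝ) ^ ε * (AQ * c ^ E + AP * c ^ E) :=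
        mul_le_mul_of_nonneg_left
          (add_le_add (mul_le_mul_of_nonneg_left h2 hAQ) (mul_le_mul_of_nonneg_left h3 hAP)) h4
    _ = K * (2 : ℝ) ^ ε * (AQ + AP) * c ^ E := by ring

/-! ## The stub -/

/-- **Stub `SliceClassBoundHigh`** of line `peyre-level-torsor-v22` (crux stmt-ABC-2757
`TwistAmplification.MazurKaneLaw`), registered form. Given the RESTRICTED shape-level bound — for
`5/3 ≤ s < 2`, `0 < ε ≤ 1/4`, `0 < η ≤ 1/12` a constant `K` with
`shapeCount ≤ K (c₃ shapeVal Z)^ε (∏_{i ≥ 2} XᵢYᵢZᵢ + ∏ᵢ XᵢYᵢZᵢ/(c₃ shapeVal Z))` on all data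
admissible for `(s + ε, ε)` satisfying the slice lower bound
`C₀^{s-η} ≤ (2C₀)^{3ε/2} 8^{M} ∏ᵢ XᵢYᵢZᵢ` (`M = numShapes ε`) — there is, for the same ranges,
`K' ≥ 0` with `shapeCount ≤ K' · C₀^{s - 1 + 5ε + η}` on the same data. Pure real-inequality
bookkeeping: `(c₃ shapeVal Z)^ε ≤ (2C₀)^ε`; the main term is `≤ 2^{s+4ε} V₂ C₀^{s-1+4ε}`
(`le_valZ`, `prod_le`); the level term is `≤ (2^{3+3ε/2} 8^M)^{1/2} C₀^{(3-s)/2 + 3ε/4 + η/2}` by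
the structure inequality `(∏P)³ ≤ (2C₀)³ P₀² P₁` and the slice lower bound; finally
`(3-s)/2 ≤ s-1` as `s ≥ 5/3`. [folklore] -/
theorem SliceClassBoundHigh : (∀ s : ℝ, 5 / 3 ≤ s → s < 2 → ∀ ε : ℝ, 0 < ε → ε ≤ 1 / 4 → ∀ η : ℝ, 0 < η → η ≤ 1 / 12 → ∃ K : ℝ, ∀ (C₀ c₁ c₂ c₃ : ℕ) (X Y Z : Fin (Literature.NumberTheory.DiophantineGeometry.AbcShapes.numShapes ε) → ℕ), Literature.NumberTheory.DiophantineGeometry.AbcShapes.Admissible (s + ε) ε C₀ c₁ c₂ c₃ X Y Z → ((C₀ : ℝ) ^ (s - η) ≤ (2 * (C₀ : ℝ)) ^ (3 * ε / 2) * (8 : ℝ) ^ (Literature.NumberTheory.DiophantineGeometry.AbcShapes.numShapes ε) * ∏ i, ((X i : ℝ) * Y i * Z i)) → (Literature.NumberTheory.DiophantineGeometry.AbcShapes.shapeCount c₁ c₂ c₃ X Y Z : ℝ) ≤ K * ((c₃ : ℝ) * ((Literature.NumberTheory.DiophantineGeometry.AbcShapes.shapeVal Z : ℕ) : ℝ))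 ^ ε * ((∏ i ∈ Finset.univ.filter (fun i : Fin (Literature.NumberTheory.DiophantineGeometry.AbcShapes.numShapes ε) => 2 ≤ (i : ℕ)), ((X i : ℝ) * Y i * Z i)) + (∏ i, ((X i : ℝ) * Y i * Z i)) / ((c₃ : ℝ) * ((Literature.NumberTheory.DiophantineGeometry.AbcShapes.shapeVal Z : ℕ) : ℝ)))) → ∀ s : ℝ, 5 / 3 ≤ s → s < 2 → ∀ ε : ℝ, 0 < ε → ε ≤ 1 / 4 → ∀ η : ℝ, 0 < η → η ≤ 1 / 12 → ∃ K : ℝ, 0 ≤ K ∧ ∀ (C₀ c₁ c₂ c₃ : ℕ) (X Y Z : Fin (Literature.NumberTheory.DiophantineGeometry.AbcShapes.numShapes ε) → ℕ), Literature.NumberTheory.DiophantineGeometry.AbcShapes.Admissible (s + ε) ε C₀ c₁ c₂ c₃ X Y Z → ((C₀ : ℝ) ^ (s - η) ≤ (2 * (C₀ : ℝ)) ^ (3 * ε / 2) * (8 : ℝ) ^ (Literature.NumberTheory.DiophantineGeometry.AbcShapes.numShapes ε) * ∏ i, ((X i : ℝ) * Y i * Z i)) → (Literature.NumberTheory.DiophantineGeometry.AbcShapes.shapeCount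 c₁ c₂ c₃ X Y Z : ℝ) ≤ K * (C₀ : ℝ) ^ (s - 1 + 5 * ε + η) := by
  intro hSLB s hs1 hs2 ε hε hε4 η hη hη12
  have h6 : 6 ≤ numShapes ε := six_le_numShapes hε hε4
  obtain ⟨K, hK⟩ := hSLB s hs1 hs2 ε hε hε4 η hη hη12
  -- the constant: `max K 0 · 2^ε · (A_Q + A_P)`
  refine ⟨max K 0 * (2 : ℝ) ^ ε *
      (Real.sqrt ((2 : ℝ) ^ (3 + 3 * ε / 2) * 8 ^ numShapes ε) +
        (2 : ℝ) ^ (s + ε + 3 * ε) * ((shapeVal (fun _ : Fin (numShapes ε) => 2) : ℕ) : ℝ)),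
    by positivity, ?_⟩
  intro C₀ c₁ c₂ c₃ X Y Z hA hSL
  -- positivity and casts of the admissibility constraints
  have hc1 : (1 : ℝ) ≤ (C₀ : ℝ) := by exact_mod_cast hA.one_le
  have hc0 : (0 : ℝ) < (C₀ : ℝ) := by linarith
  have hsV : 0 < shapeVal Z := shapeVal_pos hA.Z_pos
  have hc₃ : 0 < c₃ := hA.pos₃
  have hV0 : (0 : ℝ) < (c₃ : ℝ) * ((shapeVal Z : ℕ) : ℝ) := by positivity
  have hVc : (c₃ : ℝ) * ((shapeVal Z : ℕ) : ℝ) ≤ 2 * (C₀ : ℝ) := by exact_mod_cast hA.valZ_le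
  have hcV : (C₀ : ℝ) ≤ ((shapeVal (fun _ : Fin (numShapes ε) => 2) : ℕ) : ℝ) *
      ((c₃ : ℝ) * ((shapeVal Z : ℕ) : ℝ)) := by exact_mod_cast hA.le_valZ
  have hP0 : (0 : ℝ) < ∏ i, ((X i : ℝ) * Y i * Z i) := prod_pos fun i _ => by
    have := hA.X_pos i; have := hA.Y_pos i; have := hA.Z_pos i; positivity
  have hQ0 : (0 : ℝ) ≤ ∏ i ∈ Finset.univ.filter (fun i : Fin (numShapes ε) => 2 ≤ (i : ℕ)),
      ((X i : ℝ) * Y i * Z i) := prod_nonneg fun i _ => by positivity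
  -- the coordinates `0` (linear) and `1` (square)
  have hi0 : 0 < numShapes ε := by omega
  have hi1 : 1 < numShapes ε := by omega
  have hP₀ : (0 : ℝ) < (X ⟨0, hi0⟩ : ℝ) * Y ⟨0, hi0⟩ * Z ⟨0, hi0⟩ := by
    have := hA.X_pos ⟨0, hi0⟩; have := hA.Y_pos ⟨0, hi0⟩; have := hA.Z_pos ⟨0, hi0⟩; positivity
  have hP₁ : (1 : ℝ) ≤ (X ⟨1, hi1⟩ : ℝ) * Y ⟨1, hi1⟩ * Z ⟨1, hi1⟩ := by
    have h := Nat.mul_pos (Nat.mul_pos (hA.X_pos ⟨1, hi1⟩) (hA.Y_pos ⟨1, hi1⟩)) (hA.Z_pos ⟨1, hi1⟩)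
    exact_mod_cast Nat.one_le_iff_ne_zero.mpr h.ne'
  have hsplit := sliceClassBoundHigh_prod_split (fun i => (X i : ℝ) * Y i * Z i) ⟨0, hi0⟩
    ⟨1, hi1⟩ rfl rfl
  have hcube := sliceClassBoundHigh_prod_cube_le_admissible hA ⟨0, hi0⟩ ⟨1, hi1⟩ rfl rfl
  -- the three bounds
  have hW := sliceClassBoundHigh_rpow_le hV0.le hc0.le hε.le hVc
  have hR := sliceClassBoundHigh_main_term hP0.le hV0 hc0 (Nat.cast_nonneg _) hcV hA.prod_le
  have hQ := sliceClassBoundHigh_le_sqrt_mul_rpow hQ0 (by positivity) hc0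
    (sliceClassBoundHigh_level_sq hc0 hQ0 hP₀ hP₁ hsplit hcube hSL)
  -- the (restricted) hypothesis on these data, with `K ≤ max K 0`
  have hB := (hK C₀ c₁ c₂ c₃ X Y Z hA hSL).trans
    (mul_le_mul_of_nonneg_right (mul_le_mul_of_nonneg_right (le_max_left K 0) (by positivity))
      (add_nonneg hQ0 (div_nonneg hP0.le hV0.le)))
  refine sliceClassBoundHigh_assemble (le_max_right K 0) hc1 hW hQ0 hQ (div_nonneg hP0.le hV0.le)
    hR (Real.sqrt_nonneg _) (by positivity) ?_ ?_ hB
  · linarith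
  · linarith

end Summit.ABC.ABC.Theorems
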